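import Summits.QuantumFields.BalabanUV.T4Continuum.Support.NE7AbelianAxialHomotopy
import Mathlib.Analysis.InnerProductSpace.Basic
import HarnessLib

/-!
# NE7 — THE NEUMANN–POINCARÉ INEQUALITY FOR CO-CLOSED 1-FORMS ON A LATTICE BOX (F307b, ROAD (U) brick (B2-i) part 2): if `A ⊥` every gradient supported on the box
# (the free-boundary Landau condition) and every plaquette value of `dA` inside the box is `≤ a`, then `Σ_{bonds of the box} ‖A‖² ≤ #bonds·(|hi − lo|₁·a)²` —
# `⟨A, A⟩ = ⟨A, A − dψ⟩` with the axial potential `ψ`, Cauchy–Schwarz, and F307a's pointwise homotopy bound `‖A − dψ‖ ≤ |x − lo|₁·a`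

Cell `pub-balaban`, rung (B)+1 sub-cell t4, lineage `b2b-balaban-t4-ne7-p1` (CRUX PROVER NE7 #1 = OWNER of row NE7), generation 92; memo
`t4/b2b-balaban-t4-ne7-p1-g92/LOG-OBSTRUCTION.md` §4b (B2-i).  Over F307a `NE7AbelianAxialHomotopy.norm_axial_defect_le'`.

WHY.  The sup letter of the free-boundary cube Landau gauge (F304′∕F305′∕F306's hypothesis) is a GLOBAL statement on the cube: interior regularity never improves a sup;
the gain comes from orthogonality to gradients plus `H¹(box) = 0`.  This file is the L² form of that gain with an explicit constant, for a general coefficient space `E`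
(a normed ring carrying a compatible real inner product — e.g. `ℂ`, applied entrywise to matrix fields): the first brick of ROAD (U).  The L² → L^∞ step (discrete
mean value) and the nonlinear∕`sinh` perturbation are NOT here.
WHAT ([folklore]; 0 def, 0 sorry).  §1 `l1_sub_le_of_mem_box`.  §2 **`sum_norm_sq_le_of_coclosed`**: for `lo ≤ hi`, the bond set
`B = {(x, μ) : lo ≤ x, x + e_μ ≤ hi}`, `A ⊥` all gradients on `B` (weak Neumann co-closedness) and `‖dA‖ ≤ a` on the plaquettes of `[lo, hi]`:
`Σ_{b ∈ B} ‖A b‖² ≤ #B·(|hi − lo|₁·a)²`.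
HONEST FRAMING (page 1): elementary lattice calculus; nothing of Bałaban's asserted; NE7 NOT PROVED; spine 0∕9; finite T⁴ rung (B)+1 — NOT infinite volume, NOT mass gap, NOT
`BetaPertH`, NOT Clay.  Continuum YM on T⁴ ⇐ BetaPertH ∧ nine spine estimates (0/9 proved); BetaPertH ⇐ (D1) ∧ (D4) ∧ CAP+tail; G-an2-4 gates asym, D1 and NE2/3/4.
No `sorry`; axioms ⊆ {propext, Classical.choice, Quot.sound}.
-/

set_option autoImplicit false

open scoped BigOperators RealInnerProductSpace
open Finset

namespace Summit.QuantumFields.BalabanUV.T4Continuum.NE7NeumannPoincareCube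

open Literature.MathematicalPhysics.QuantumFieldTheory.Balaban1983to89
open B7Prop1Explicit
open NE7AbelianAxialHomotopy (norm_axial_defect_le')

variable {d : ℕ} {E : Type*} [NormedRing E] [InnerProductSpace ℝ E]

/-! ## §1 Bookkeeping -/

omit [InnerProductSpace ℝ E] in
/-- `|x − lo|₁ ≤ |hi − lo|₁` for `lo ≤ x ≤ hi`. [folklore] -/
theorem l1_sub_le_of_mem_box {lo hi x : Site d} (h1 : lo ≤ x) (h2 : x ≤ hi) : l1 (x - lo) ≤ l1 (hi - lo) := by
  unfold l1
  refine Finset.sum_le_sum fun κ _ => ?_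
  have a1 : 0 ≤ (x - lo) κ := by have := h1 κ; simp only [Pi.sub_apply]; linarith
  have a2 : (x - lo) κ ≤ (hi - lo) κ := by have := h2 κ; simp only [Pi.sub_apply]; linarith
  have : ((x - lo) κ).natAbs ≤ ((hi - lo) κ).natAbs := by
    have e1 : (((x - lo) κ).natAbs : ℤ) = (x - lo) κ := Int.natAbs_of_nonneg a1
    have e2 : (((hi - lo) κ).natAbs : ℤ) = (hi - lo) κ := Int.natAbs_of_nonneg (a1.trans a2)
    have : (((x - lo) κ).natAbs : ℤ) ≤ (((hi - lo) κ).natAbs : ℤ) := by rw [e1, e2]; exact a2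
    exact_mod_cast this
  exact this

/-! ## §2 The Neumann–Poincaré inequality -/

set_option maxHeartbeats 800000 in
/-- **THE NEUMANN–POINCARÉ INEQUALITY FOR CO-CLOSED 1-FORMS ON A BOX.**  Let `B` be a finite set of bonds `(x, μ)` all satisfying `lo ≤ x`, `x + e_μ ≤ hi`; let
`A : ℤᵈ → (Fin d → E)` be weakly co-closed on `B` — `Σ_{(x,μ) ∈ B} ⟪A(x,μ), φ(x+e_μ) − φ(x)⟫ = 0` for every site function `φ` — and let `‖dA(p; κ, ν)‖ ≤ a` for every
plaquette with `lo ≤ p`, `p + e_κ + e_ν ≤ hi`.  Then `Σ_{b ∈ B} ‖A b‖² ≤ #B·(|hi − lo|₁·a)²`. [folklore] -/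
theorem sum_norm_sq_le_of_coclosed (A : Site d → Fin d → E) {lo hi : Site d} {a : ℝ} (ha : 0 ≤ a) (B : Finset (Site d × Fin d))
    (hB : ∀ b ∈ B, lo ≤ b.1 ∧ b.1 + e b.2 ≤ hi)
    (hco : ∀ φ : Site d → E, ∑ b ∈ B, ⟪A b.1 b.2, φ (b.1 + e b.2) - φ b.1⟫ = 0)
    (hP : ∀ (p : Site d) (κ ν : Fin d), κ ≠ ν → lo ≤ p → p + e κ + e ν ≤ hi → ‖asum A p (plaqWord κ ν)‖ ≤ a) :
    ∑ b ∈ B, ‖A b.1 b.2‖ ^ 2 ≤ (B.card : ℝ) * ((l1 (hi - lo) : ℝ) * a) ^ 2 := by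
  -- the axial potential and the defect
  set ψ : Site d → E := fun z => asum A lo (treeWord (z - lo)) with hψ
  set D : Site d → Fin d → E := fun z ν => asum A lo (treeWord (z - lo)) + A z ν - asum A lo (treeWord (z + e ν - lo)) with hD
  have hsplit : ∀ z ν, A z ν = D z ν + (ψ (z + e ν) - ψ z) := fun z ν => by simp only [hD, hψ]; abel
  -- pointwise bound on the defect
  have hDb : ∀ b ∈ B, ‖D b.1 b.2‖ ≤ (l1 (hi - lo) : ℝ) * a := by
    intro b hb
    obtain ⟨h1, h2⟩ := hB b hb
    have e1 : ∀ (i : Fin d), (0 : ℤ) ≤ (e b.2 : Site d) i := fun i => by rw [e_apply]; split_ifs <;> norm_num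
    have hx : b.1 ≤ hi := fun κ => by have := h2 κ; have := e1 κ; simp only [Pi.add_apply] at *; linarith
    have h := norm_axial_defect_le' A ha hP lo b.1 b.2 le_rfl h1 h2
    refine h.trans (mul_le_mul_of_nonneg_right ?_ ha)
    exact_mod_cast l1_sub_le_of_mem_box h1 hx
  -- `⟨A, A⟩ = ⟨A, D⟩`
  have hAA : ∑ b ∈ B, ‖A b.1 b.2‖ ^ 2 = ∑ b ∈ B, ⟪A b.1 b.2, D b.1 b.2⟫ := by
    have h0 := hco ψ
    calc ∑ b ∈ B, ‖A b.1 b.2‖ ^ 2 = ∑ b ∈ B, ⟪A b.1 b.2, A b.1 b.2⟫ := Finset.sum_congr rfl fun b _ => (real_inner_self_eq_norm_sq _).symm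
      _ = ∑ b ∈ B, (⟪A b.1 b.2, D b.1 b.2⟫ + ⟪A b.1 b.2, ψ (b.1 + e b.2) - ψ b.1⟫) :=
          Finset.sum_congr rfl fun b _ => by rw [← inner_add_right, ← hsplit]
      _ = ∑ b ∈ B, ⟪A b.1 b.2, D b.1 b.2⟫ := by rw [Finset.sum_add_distrib, h0, add_zero]
  -- Cauchy–Schwarz
  have hCS : ∑ b ∈ B, ⟪A b.1 b.2, D b.1 b.2⟫ ≤ Real.sqrt (∑ b ∈ B, ‖A b.1 b.2‖ ^ 2) * Real.sqrt (∑ b ∈ B, ‖D b.1 b.2‖ ^ 2) := by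
    calc ∑ b ∈ B, ⟪A b.1 b.2, D b.1 b.2⟫ ≤ ∑ b ∈ B, ‖A b.1 b.2‖ * ‖D b.1 b.2‖ := Finset.sum_le_sum fun b _ => real_inner_le_norm _ _
      _ ≤ Real.sqrt (∑ b ∈ B, ‖A b.1 b.2‖ ^ 2) * Real.sqrt (∑ b ∈ B, ‖D b.1 b.2‖ ^ 2) :=
          Real.sum_mul_le_sqrt_mul_sqrt B (fun b => ‖A b.1 b.2‖) (fun b => ‖D b.1 b.2‖)
  have hS0 : 0 ≤ ∑ b ∈ B, ‖A b.1 b.2‖ ^ 2 := Finset.sum_nonneg fun b _ => by positivity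
  have hT0 : 0 ≤ ∑ b ∈ B, ‖D b.1 b.2‖ ^ 2 := Finset.sum_nonneg fun b _ => by positivity
  have hmain : ∑ b ∈ B, ‖A b.1 b.2‖ ^ 2 ≤ ∑ b ∈ B, ‖D b.1 b.2‖ ^ 2 := by
    -- `X ≤ √X·√Y ⟹ X ≤ Y` (as in `RegionGaugeSliceOrth.le_of_le_sqrt_mul_sqrt`)
    have h := hCS; rw [← hAA] at h
    nlinarith [sq_nonneg (Real.sqrt (∑ b ∈ B, ‖A b.1 b.2‖ ^ 2) - Real.sqrt (∑ b ∈ B, ‖D b.1 b.2‖ ^ 2)), Real.sq_sqrt hS0, Real.sq_sqrt hT0]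
  refine hmain.trans ?_
  calc ∑ b ∈ B, ‖D b.1 b.2‖ ^ 2 ≤ ∑ _b ∈ B, ((l1 (hi - lo) : ℝ) * a) ^ 2 := Finset.sum_le_sum fun b hb => by
          have := hDb b hb
          have h0 : 0 ≤ ‖D b.1 b.2‖ := norm_nonneg _
          nlinarith
    _ = (B.card : ℝ) * ((l1 (hi - lo) : ℝ) * a) ^ 2 := by rw [Finset.sum_const, nsmul_eq_mul]

end Summit.QuantumFields.BalabanUV.T4Continuum.NE7NeumannPoincareCube
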